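import Literature.NumberTheory.LFunctions.StarkHadamardPositivity
import HarnessLib

/-!
# The Hadamard expansion of a symmetric entire function of order `< 2`, as reusable data

Topic `Literature/NumberTheory/LFunctions`, namespace `Literature.NumberTheory.LFunctions.Stark1974`
(companion of `StarkHadamardPositivity.lean`, whose proof of `re_logDeriv_nonneg_of_symmetric` builds
this expansion internally).  Everything here is PROVED; `SymmHadamardData` is a structure packaging
the output of Hadamard's genus-zero theorem, `SymmHadamardData.node` is a definition with body.

For an entire `F` with `F(1 − s) = F(s)`, `‖F(s)‖ ≤ C exp(‖s‖^μ)` (`0 ≤ μ < 2`) and all zeros in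
`Re s ≤ 1` (e.g. the completed zeta functions `ξ_K` of the tree, `exists_starkXi`), the even lift
`G(w) = F(1/2 + √w)` is entire of order `< 1`, so (Conway XI.3.4, tree
`Literature.Analysis.Complex.hadamard_genus_zero_holds`)

  `F(1/2 + z) = z^{2m} · A · ∏ₙ (1 + cₙ z²)`,   `∑ ‖cₙ‖ < ∞`,  every root `ζ` of `cₙ ζ² = −1` has `|Re ζ| ≤ 1/2`

(`exists_symmHadamardData`); the zeros of `F` other than `1/2` are the `1/2 ± ζₙ`
(`SymmHadamardData.exists_index_of_zero`), and at every `s` with `F(s) ≠ 0`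

  `F'/F(s) = 2m/(s − 1/2) + ∑ₙ 2cₙ(s − 1/2)/(1 + cₙ(s − 1/2)²)`
  `         = 2m/(s − 1/2) + ∑ₙ [1/(s − 1/2 − ζₙ) + 1/(s − 1/2 + ζₙ)]`      (`SymmHadamardData.logDeriv_eq`).

This is the "logarithmic differentiation of the Hadamard factorization" `∑_ρ 1/(s − ρ)` of Stark 1974,
Lemma 3 / Murty–Murty Prop. 6.1, now available at COMPLEX points (the input of the higher-derivative
explicit formulae behind the Deuring–Heilbronn phenomenon, Lagarias–Montgomery–Odlyzko 1979 §5,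
Thorner–Zaman 2017 §7).

## References

* H. M. Stark, *Some effective cases of the Brauer–Siegel theorem*, Invent. Math. 23 (1974), Lemma 3. [Stark1974]
* J. B. Conway, *Functions of One Complex Variable I*, Ch. XI Thm. 3.4. [Conway1978]
* J. Thorner, A. Zaman, Algebra Number Theory 11 (2017), §2 (explicit formula with all zeros). [ThornerZaman2017]
-/

noncomputable section

open Complex Filter Topology Metric Set

namespace Literature.NumberTheory.LFunctions.Stark1974

/-- **The Hadamard data of a symmetric entire function**: `F(1/2 + z) = z^{2m} A ∏ₙ (1 + cₙ z²)` with
`A ≠ 0`, `∑ ‖cₙ‖ < ∞`, and every root of a factor in the closed strip `|Re ζ| ≤ 1/2`.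
[cite: Conway1978, Ch. XI Thm. 3.4] -/
structure SymmHadamardData (F : ℂ → ℂ) where
  /-- half the order of vanishing at `1/2` -/
  m : ℕ
  /-- the leading constant -/
  A : ℂ
  /-- the coefficients of the quadratic factors -/
  c : ℕ → ℂ
  A_ne : A ≠ 0
  summable : Summable fun n ↦ ‖c n‖
  prod_eq : ∀ z : ℂ, F (1 / 2 + z) = z ^ (2 * m) * (A * ∏' n, (1 + c n * z ^ 2))
  root_re : ∀ (n : ℕ) (ζ : ℂ), c n * ζ ^ 2 = -1 → |ζ.re| ≤ 1 / 2

/-- **Existence of the Hadamard data** for an entire `F` with `F(1 − s) = F(s)`,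
`‖F(s)‖ ≤ C exp(‖s‖^μ)` (`0 ≤ μ < 2`) and all zeros in `Re s ≤ 1` (the construction inside the proof of
`re_logDeriv_nonneg_of_symmetric`: even lift, removal of the zero at the origin, Hadamard in genus zero).
[cite: Conway1978, Ch. XI Thm. 3.4] -/
theorem exists_symmHadamardData {F : ℂ → ℂ} (hF : Differentiable ℂ F)
    (hsymm : ∀ s, F (1 - s) = F s) {C μ : ℝ} (hμ : μ < 2) (hμ0 : 0 ≤ μ)
    (hgrowth : ∀ s, ‖F s‖ ≤ C * Real.exp (‖s‖ ^ μ)) (hzero : ∀ s, F s = 0 → s.re ≤ 1) :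
    Nonempty (SymmHadamardData F) := by
  have hFne : ∀ s : ℂ, 1 < s.re → F s ≠ 0 := fun s hs h ↦ by linarith [hzero s h]
  set g : ℂ → ℂ := fun z ↦ F (1 / 2 + z) with hg
  have hg_diff : Differentiable ℂ g := hF.comp ((differentiable_const _).add differentiable_id)
  have hg_even : ∀ z, g (-z) = g z := fun z ↦ by
    simp only [hg]
    rw [← hsymm (1 / 2 + z)]
    congr 1
    ring
  obtain ⟨C₁, hC₁0, hC₁⟩ := growth_shift hμ0 hgrowth (1 / 2) (show μ < (μ + 2) / 2 by linarith)
  set G : ℂ → ℂ := fun w ↦ g (w ^ (2⁻¹ : ℂ)) with hGdef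
  have hG_diff : Differentiable ℂ G := Newman.differentiable_comp_cpow_half hg_diff hg_even
  have hG_sq : ∀ z, G (z ^ 2) = g z := fun z ↦ Newman.comp_cpow_half_apply_sq hg_even z
  have hG_growth : ∀ w, ‖G w‖ ≤ C₁ * Real.exp (‖w‖ ^ ((μ + 2) / 4)) := by
    intro w
    have h := hC₁ (w ^ (2⁻¹ : ℂ))
    have hn : ‖w ^ (2⁻¹ : ℂ)‖ = ‖w‖ ^ (2⁻¹ : ℝ) := by
      rw [show (2⁻¹ : ℂ) = ((2⁻¹ : ℝ) : ℂ) by push_cast; ring, Complex.norm_cpow_real]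
    rw [hn, ← Real.rpow_mul (norm_nonneg _)] at h
    have he : (2⁻¹ : ℝ) * ((μ + 2) / 2) = (μ + 2) / 4 := by ring
    rwa [he] at h
  have hρ : (μ + 2) / 4 < 1 := by linarith
  have hG_ne : G ((3 / 2 : ℂ) ^ 2) ≠ 0 := by
    rw [hG_sq]
    simp only [hg]
    have : (1 / 2 : ℂ) + 3 / 2 = 2 := by norm_num
    rw [this]
    exact hFne 2 (by norm_num)
  obtain ⟨m, G₁, hG₁_diff, hG₁0, hG₁_eq⟩ := exists_eq_pow_mul hG_diff hG_ne
  obtain ⟨C₂, hC₂⟩ := growth_of_eq_pow_mul hG₁_diff hG₁_eq hG_growth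
  obtain ⟨b, hb_sum, hb_prod⟩ :=
    Literature.Analysis.Complex.hadamard_genus_zero_holds G₁ _ C₂ hG₁_diff hρ hC₂ hG₁0
  set c : ℕ → ℂ := fun n ↦ -b n with hc
  have hc_sum : Summable fun n ↦ ‖c n‖ := by simpa [hc] using hb_sum
  have hprod : ∀ z, HasProd (fun n ↦ 1 + c n * z ^ 2) (G₁ (z ^ 2) / G₁ 0) := fun z ↦ by
    have := hb_prod (z ^ 2)
    simpa [hc, sub_eq_add_neg] using this
  have hg_eq : ∀ z, g z = z ^ (2 * m) * (G₁ 0 * ∏' n, (1 + c n * z ^ 2)) := fun z ↦ by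
    rw [← hG_sq, hG₁_eq, (hprod z).tprod_eq, pow_mul]
    field_simp
  have hroot : ∀ n ζ, c n * ζ ^ 2 = -1 → |ζ.re| ≤ 1 / 2 := by
    intro n ζ hζ
    have hGz : G₁ (ζ ^ 2) = 0 := by
      have h0 : G₁ (ζ ^ 2) / G₁ 0 = 0 :=
        Newman.eq_zero_of_hasProd_of_eq_zero (hprod ζ) (k := n) (by rw [hζ]; ring)
      exact (div_eq_zero_iff.1 h0).resolve_right hG₁0
    have hgζ : ∀ η, η ^ 2 = ζ ^ 2 → g η = 0 := fun η hη ↦ by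
      rw [← hG_sq, hη, hG₁_eq, hGz, mul_zero]
    have h1 := hzero _ (hgζ ζ rfl)
    have h2 := hzero _ (hgζ (-ζ) (by ring))
    simp only [add_re, neg_re] at h1 h2
    norm_num at h1 h2
    rw [abs_le]
    constructor <;> linarith
  exact ⟨{ m := m, A := G₁ 0, c := c, A_ne := hG₁0, summable := hc_sum
           prod_eq := fun z ↦ hg_eq z, root_re := hroot }⟩

namespace SymmHadamardData

variable {F : ℂ → ℂ} (D : SymmHadamardData F)

/-- A square root of `−1/cₙ`: `ζₙ = (−cₙ⁻¹)^{1/2}`, so that `cₙ ζₙ² = −1` when `cₙ ≠ 0`. [folklore] -/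
def node (n : ℕ) : ℂ := (-(D.c n)⁻¹) ^ (2⁻¹ : ℂ)

/-- `cₙ ζₙ² = −1` for `cₙ ≠ 0`. [folklore] -/
theorem c_mul_node_sq {n : ℕ} (hn : D.c n ≠ 0) : D.c n * D.node n ^ 2 = -1 := by
  rw [node, cpow_ofNat_inv_pow _ 2]
  field_simp

/-- The roots lie in the closed strip: `|Re ζₙ| ≤ 1/2`. [cite: Stark1974, Lemma 3 (proof)] -/
theorem abs_re_node_le {n : ℕ} (hn : D.c n ≠ 0) : |(D.node n).re| ≤ 1 / 2 :=
  D.root_re n _ (D.c_mul_node_sq hn)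

/-- The zeros `1/2 ± ζₙ` lie in `0 ≤ Re ≤ 1`. [cite: Stark1974, Lemma 3 (proof)] -/
theorem re_half_add_node_mem {n : ℕ} (hn : D.c n ≠ 0) :
    0 ≤ ((1 / 2 : ℂ) + D.node n).re ∧ ((1 / 2 : ℂ) + D.node n).re ≤ 1 ∧
      0 ≤ ((1 / 2 : ℂ) - D.node n).re ∧ ((1 / 2 : ℂ) - D.node n).re ≤ 1 := by
  have h := abs_le.mp (D.abs_re_node_le hn)
  simp only [add_re, sub_re]
  norm_num
  refine ⟨by linarith [h.1], by linarith [h.2], by linarith [h.2], by linarith [h.1]⟩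

/-- `F(s) = (s − 1/2)^{2m} A ∏ₙ (1 + cₙ (s − 1/2)²)`. [cite: Conway1978, Ch. XI Thm. 3.4] -/
theorem apply_eq (s : ℂ) :
    F s = (s - 1 / 2) ^ (2 * D.m) * (D.A * ∏' n, (1 + D.c n * (s - 1 / 2) ^ 2)) := by
  have := D.prod_eq (s - 1 / 2)
  rwa [show (1 / 2 : ℂ) + (s - 1 / 2) = s by ring] at this

/-- The product of the quadratic factors converges. [folklore] -/
theorem hasProd (z : ℂ) : HasProd (fun n ↦ 1 + D.c n * z ^ 2) (∏' n, (1 + D.c n * z ^ 2)) :=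
  (multipliableLocallyUniformlyOn_one_add_mul_sq D.summable (‖z‖ + 1)).multipliable
    (by simp) |>.hasProd

/-- At a point where `F ≠ 0` no factor vanishes. [folklore] -/
theorem factor_ne_zero {s : ℂ} (hs : F s ≠ 0) (n : ℕ) : 1 + D.c n * (s - 1 / 2) ^ 2 ≠ 0 := by
  intro h
  apply hs
  rw [D.apply_eq s]
  have : ∏' k, (1 + D.c k * (s - 1 / 2) ^ 2) = 0 :=
    Newman.eq_zero_of_hasProd_of_eq_zero (D.hasProd (s - 1 / 2)) (k := n) h
  rw [this, mul_zero, mul_zero]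

/-- At a point where `F ≠ 0`: `m = 0` or `s ≠ 1/2`. [folklore] -/
theorem m_eq_zero_or_ne_half {s : ℂ} (hs : F s ≠ 0) : D.m = 0 ∨ s ≠ 1 / 2 := by
  by_contra h
  push Not at h
  obtain ⟨hm, rfl⟩ := h
  apply hs
  rw [D.apply_eq]
  simp [hm]

/-- **Every zero of `F` other than `1/2` is a node**: if `F(ρ) = 0`, `ρ ≠ 1/2`, then
`cₙ(ρ − 1/2)² = −1` for some `n` with `cₙ ≠ 0`, i.e. `ρ − 1/2 = ±ζₙ`. [cite: Conway1978, Ch. XI Thm. 3.4] -/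
theorem exists_index_of_zero {ρ : ℂ} (hρ : F ρ = 0) (hρ' : ρ ≠ 1 / 2) :
    ∃ n, D.c n ≠ 0 ∧ D.c n * (ρ - 1 / 2) ^ 2 = -1 := by
  by_contra h
  push Not at h
  have hfac : ∀ n, 1 + D.c n * (ρ - 1 / 2) ^ 2 ≠ 0 := by
    intro n h0
    by_cases hn : D.c n = 0
    · rw [hn] at h0; simp at h0
    · exact h n hn (by linear_combination h0)
  have hP := tprod_one_add_mul_sq_ne_zero D.summable hfac
  apply hP
  have h2 := D.apply_eq ρ
  rw [hρ] at h2
  have hz : (ρ - 1 / 2) ^ (2 * D.m) ≠ 0 := pow_ne_zero _ (sub_ne_zero.mpr hρ')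
  have := mul_eq_zero.mp h2.symm
  rcases this with h3 | h3
  · exact absurd h3 hz
  · rcases mul_eq_zero.mp h3 with h4 | h4
    · exact absurd h4 D.A_ne
    · exact h4

/-- If `cₙ(ρ − 1/2)² = −1` then `ρ = 1/2 + ζₙ` or `ρ = 1/2 − ζₙ`. [folklore] -/
theorem eq_half_add_or_sub_node {ρ : ℂ} {n : ℕ} (hn : D.c n ≠ 0) (h : D.c n * (ρ - 1 / 2) ^ 2 = -1) :
    ρ = 1 / 2 + D.node n ∨ ρ = 1 / 2 - D.node n := by
  have h1 := D.c_mul_node_sq hn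
  have hsq : (ρ - 1 / 2) ^ 2 = D.node n ^ 2 := by
    have : D.c n * ((ρ - 1 / 2) ^ 2 - D.node n ^ 2) = 0 := by linear_combination h - h1
    rcases mul_eq_zero.mp this with h0 | h0
    · exact absurd h0 hn
    · exact sub_eq_zero.mp h0
  rcases sq_eq_sq_iff_eq_or_eq_neg.mp hsq with h2 | h2
  · left; linear_combination h2
  · right; linear_combination h2

/-- **The logarithmic derivative** at a point where `F ≠ 0`:
`F'/F(s) = 2m/(s − 1/2) + ∑ₙ 2cₙ(s − 1/2)/(1 + cₙ(s − 1/2)²)`.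
[cite: Stark1974, Lemma 3 (proof)] [cite: ThornerZaman2017, §2] -/
theorem logDeriv_eq (hF : Differentiable ℂ F) {s : ℂ} (hs : F s ≠ 0) :
    logDeriv F s = 2 * D.m / (s - 1 / 2) +
      ∑' n, 2 * D.c n * (s - 1 / 2) / (1 + D.c n * (s - 1 / 2) ^ 2) := by
  set z₀ : ℂ := s - 1 / 2 with hz₀
  set g : ℂ → ℂ := fun z ↦ F (1 / 2 + z) with hg
  have hfac := D.factor_ne_zero hs
  have hσz₀ : (1 / 2 : ℂ) + z₀ = s := by rw [hz₀]; ring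
  have hP_diff : Differentiable ℂ (fun z ↦ ∏' n, (1 + D.c n * z ^ 2)) :=
    differentiable_tprod_one_add_mul_sq D.summable
  have hPz₀ : ∏' n, (1 + D.c n * z₀ ^ 2) ≠ 0 := tprod_one_add_mul_sq_ne_zero D.summable hfac
  -- `logDeriv F s = logDeriv g z₀`
  have hlog1 : logDeriv F s = logDeriv g z₀ := by
    have hcomp : g = F ∘ fun z ↦ 1 / 2 + z := rfl
    rw [hcomp, logDeriv_comp (by rw [hσz₀]; exact (hF _)) (((differentiable_const _).add differentiable_id) _),
      hσz₀]
    have hd : deriv (fun z : ℂ ↦ 1 / 2 + z) z₀ = 1 := by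
      rw [deriv_const_add, deriv_id'']
    rw [hd, mul_one]
  have hg_fun : g = fun z ↦ z ^ (2 * D.m) * (D.A * ∏' n, (1 + D.c n * z ^ 2)) := funext D.prod_eq
  rcases D.m_eq_zero_or_ne_half hs with hm | hne
  · -- no zero at `1/2`: the power factor is `1`
    rw [hlog1, hg_fun, hm]
    simp only [mul_zero, pow_zero, one_mul, Nat.cast_zero, zero_div, zero_add]
    rw [logDeriv_const_mul (f := fun z ↦ ∏' n, (1 + D.c n * z ^ 2)) z₀ D.A D.A_ne,
      logDeriv_tprod_one_add_mul_sq D.summable hfac]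
  · have hz₀0 : z₀ ≠ 0 := sub_ne_zero.mpr hne
    rw [hlog1, hg_fun,
      logDeriv_mul (f := fun z ↦ z ^ (2 * D.m)) (g := fun z ↦ D.A * ∏' n, (1 + D.c n * z ^ 2))
        z₀ (pow_ne_zero _ hz₀0) (mul_ne_zero D.A_ne hPz₀) (differentiableAt_pow _)
        ((hP_diff z₀).const_mul _),
      logDeriv_const_mul (f := fun z ↦ ∏' n, (1 + D.c n * z ^ 2)) z₀ D.A D.A_ne,
      logDeriv_tprod_one_add_mul_sq D.summable hfac]
    have hpow : logDeriv (fun z : ℂ ↦ z ^ (2 * D.m)) z₀ = 2 * D.m / z₀ := by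
      rw [show (fun z : ℂ ↦ z ^ (2 * D.m)) = (· ^ (2 * D.m)) from rfl, logDeriv_pow]
      push_cast
      ring
    rw [hpow]

/-- The terms of the expansion, in root form: `2cₙz/(1 + cₙz²) = 1/(z − ζₙ) + 1/(z + ζₙ)` for `cₙ ≠ 0`,
and `= 0` for `cₙ = 0`. [folklore] -/
theorem term_eq_of_ne {n : ℕ} (hn : D.c n ≠ 0) {z : ℂ} (hz : 1 + D.c n * z ^ 2 ≠ 0) :
    2 * D.c n * z / (1 + D.c n * z ^ 2) = (z - D.node n)⁻¹ + (z + D.node n)⁻¹ :=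
  term_eq_inv_add_inv (D.c_mul_node_sq hn) hz

/-- The terms of the expansion vanish for `cₙ = 0`. [folklore] -/
theorem term_eq_zero_of_eq {n : ℕ} (hn : D.c n = 0) (z : ℂ) : 2 * D.c n * z / (1 + D.c n * z ^ 2) = 0 := by
  rw [hn]; simp

/-- The expansion is absolutely summable. [folklore] -/
theorem summable_terms (z : ℂ) : Summable fun n ↦ 2 * D.c n * z / (1 + D.c n * z ^ 2) :=
  summable_logDeriv_terms D.summable z

/-- The nodes are not at the point: `z ≠ ±ζₙ` when the `n`-th factor does not vanish at `z`. [folklore] -/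
theorem sub_node_ne_zero {n : ℕ} (hn : D.c n ≠ 0) {z : ℂ} (hz : 1 + D.c n * z ^ 2 ≠ 0) :
    z - D.node n ≠ 0 ∧ z + D.node n ≠ 0 := by
  have h1 := D.c_mul_node_sq hn
  constructor
  · intro h0
    apply hz
    rw [sub_eq_zero.mp h0]
    linear_combination h1
  · intro h0
    apply hz
    have : z = -D.node n := by linear_combination h0
    rw [this]
    linear_combination h1

end SymmHadamardData

end Literature.NumberTheory.LFunctions.Stark1974

end
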